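import Summits.AnomalousDissipation.AnomalousDissipation.Theses.EnsembleRigidity
import Summits.AnomalousDissipation.AnomalousDissipation.Theses.TameRoughRigidity
import HarnessLib

/-!
# Line `regime-split` — crux `EnsembleRigidity.GPStatisticalRigidity` (stmt-AnomalousDissipation-15508)
# ALTERNATIVE skeleton (crux-strategist, 2026-08-17): the ENSTROPHY-REGIME split N / K / R as a switchable crux line

This file makes the typed decomposition filed by the sibling route `TameRoughRigidity`
(planner-plan-lens3-AnomalousDissipation-decomp-0, 2026-08-17; items stmt-18400/18402/18401, split support stmt-18403)
available ON THIS CRUX as a checked line: the three stubs are the sibling route's declarations BY NAME, so each is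
discharged by `exact <landed theorem>` the day the corresponding item closes, and the composition below is a
sorry-free proof of `N → K → R → X` concluding the crux BY NAME. No new mathematics; a bridge line recorded so the
continuation lead can switch architectures at a cycle boundary without re-deriving the split.

* `stub_eulerCoercive` (N = `TameRoughRigidity.GPEulerCoercive`, stmt-18400) — `f_GP` carries NO stationary
  statistical solution of forced EULER in the FMRT class (the `R = 0` kill class of X negated; necessary for X by
  `Negative/EulerSSS.not_gpStatisticalRigidity_of_eulerSSS`). Open problem (FGHV arXiv:1404.1098 §2.3 (ii)).
* `stub_tameClosure` (K = `TameRoughRigidity.TameClosure`, stmt-18402) — tame near-statistics (energy `≤ E`, mean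
  enstrophy `≤ G₁`, cylindrical defect `→ 0`) close up on an exact Euler statistics with the same bounds
  (Prokhorov + Rellich + cutoff cylindrical tests `χ(|P_K v|²/ρ)Φ`; size L, provable in kind; necessary for X given
  the landed desaturation).
* `stub_tameToRough` (R = `TameRoughRigidity.TameToRough`, stmt-18401) — conditional Onsager calibration: under
  the tame gap, rough admissible near-statistics pay `c ≤ R√G` (the K41 content of X; necessary for X trivially).
* `GPStatisticalRigidity_of` — X from N, K, R: (1) N + K ⇒ a defect GAP `r(E,G₁) > 0` on every tame class
  (contraposition of K, emptiness from N); (2) R(gap) ⇒ threshold `G₁(E)` and constants `(c, δ₀)` for `G ≥ G₁`;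
  (3) patch: `δ₀' = min δ₀ (r(E,G₁(E))/2)`; for `G < G₁` an admissible `μ` with defect `≤ R ≤ r/2 < r` contradicts
  the gap (vacuous), for `G ≥ G₁` apply (2). ≈ 40 tactic lines, axioms standard.

Assessment (strategist): the split is an honest equivalence (`N ∧ K ∧ R ⟺ X` given tree lemmas), K is the one
piece provable now, N is the clean shared existence problem (= `ForcedSmallScales.CyclicForceCoercive` up to an
axis swap), R isolates the rough regime where every soft argument (compactness, scaling in `E`, weak limits —
measure-valued relaxations are trivially non-rigid: rest + Reynolds stress `τ = cI + τ₁`, `P div τ₁ = f_GP`)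
fails and a RATE is needed. Formal adoption `route edit route-AnomalousDissipation-EnsembleRigidity --split
GPStatisticalRigidity --into N K R --glue-by <RigiditySplit proof>` is recommended to the tenure planner once
stmt-18403 lands (avoids a duplicate split theorem; the live direct line C2 keeps its claim meanwhile).

## Disproof used
`Negative/LoadBearing` (prob, defect load-bearing — both consumed inside R and in the patch), `Negative/EulerSSS`
(X → N: N is necessary), `Negative/DiracShadow` (Dirac instance lives in N's enemy class), Disproof §6 (uniform
constants not claimed: `G₁, c, δ₀` depend on `E`). No `-- Targets` entry hits N, K or R.
-/

set_option linter.dupNamespace false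

noncomputable section

namespace Summit.AnomalousDissipation.AnomalousDissipation.Cruxes.GPStatisticalRigidity.RegimeSplit

open MeasureTheory
open scoped ENNReal
open Summit.AnomalousDissipation.AnomalousDissipation.Theses

/-! ## Stubs (the sibling route's items, by name) -/

/-- **N** — `TameRoughRigidity.GPEulerCoercive` (stmt-AnomalousDissipation-18400): no Euler SSS of `f_GP` in the
FMRT class. [arXiv:1404.1098, arXiv:2110.08039, FoiasManleyRosaTemam2001] -/
theorem stub_eulerCoercive : TameRoughRigidity.GPEulerCoercive := by
  sorry

/-- **K** — `TameRoughRigidity.TameClosure` (stmt-AnomalousDissipation-18402): tame closure (compactness at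
bounded energy and mean enstrophy). [FoiasManleyRosaTemam2001, arXiv:1305.7089, arXiv:1411.3391] -/
theorem stub_tameClosure : TameRoughRigidity.TameClosure := by
  sorry

/-- **R** — `TameRoughRigidity.TameToRough` (stmt-AnomalousDissipation-18401): conditional Onsager calibration of
the rough regime under the tame gap. [arXiv:1706.04113, doi:10.1007/bf02099744, arXiv:1404.1098] -/
theorem stub_tameToRough : TameRoughRigidity.TameToRough := by
  sorry

/-! ## Composition: `N → K → R → X` -/

/-- **The regime split**, sorry-free: `GPEulerCoercive → TameClosure → TameToRough → GPStatisticalRigidity`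
(gap from N + K by contraposition; R's threshold; vacuity patch `δ₀' = min δ₀ (r/2)`). -/
theorem gpStatisticalRigidity_of_regimes (hN : TameRoughRigidity.GPEulerCoercive)
    (hK : TameRoughRigidity.TameClosure) (hR : TameRoughRigidity.TameToRough) :
    EnsembleRigidity.GPStatisticalRigidity := by
  intro f hf E
  -- (1) the tame gap at every (E', G₁) from N + K
  have gap : ∀ E' G₁ : ℝ, ∃ r : ℝ, 0 < r ∧
      ∀ μ : Measure (Literature.Analysis.FunctionSpaces.Torus.energySpace (Fin 3)),
        IsProbabilityMeasure μ →
        Integrable (fun v : Literature.Analysis.FunctionSpaces.Torus.energySpace (Fin 3) => ‖v‖ ^ 2) μ →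
        Literature.Analysis.FluidPDE.Torus.ensembleEnergy μ ≤ E' →
        Literature.Analysis.FluidPDE.Torus.ensembleEnstrophy μ ≤ ENNReal.ofReal G₁ →
        ¬ (∀ Φ : Literature.Analysis.FluidPDE.Torus.CylindricalTest (Fin 3),
            Integrable (fun v : Literature.Analysis.FunctionSpaces.Torus.energySpace (Fin 3) =>
              Literature.Analysis.FluidPDE.Torus.nsGeneratorPairing 0 f v (Φ.grad v)) μ ∧
            |∫ v, Literature.Analysis.FluidPDE.Torus.nsGeneratorPairing 0 f v (Φ.grad v) ∂μ| ≤
              r * Real.sqrt (∫ v, Literature.Analysis.FunctionSpaces.Torus.gradNormSq (Φ.grad v) ∂μ)) := by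
    intro E' G₁
    by_contra hgap
    push Not at hgap
    -- every r > 0 admits a tame near-statistics with defect ≤ r: K closes them up, N forbids the limit
    have hnear : ∀ r : ℝ, 0 < r → ∃ μ : Measure (Literature.Analysis.FunctionSpaces.Torus.energySpace (Fin 3)),
        IsProbabilityMeasure μ ∧
        Integrable (fun v : Literature.Analysis.FunctionSpaces.Torus.energySpace (Fin 3) => ‖v‖ ^ 2) μ ∧
        Literature.Analysis.FluidPDE.Torus.ensembleEnergy μ ≤ E' ∧
        Literature.Analysis.FluidPDE.Torus.ensembleEnstrophy μ ≤ ENNReal.ofReal G₁ ∧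
        (∀ Φ : Literature.Analysis.FluidPDE.Torus.CylindricalTest (Fin 3),
            Integrable (fun v : Literature.Analysis.FunctionSpaces.Torus.energySpace (Fin 3) =>
              Literature.Analysis.FluidPDE.Torus.nsGeneratorPairing 0 f v (Φ.grad v)) μ ∧
            |∫ v, Literature.Analysis.FluidPDE.Torus.nsGeneratorPairing 0 f v (Φ.grad v) ∂μ| ≤
              r * Real.sqrt (∫ v, Literature.Analysis.FunctionSpaces.Torus.gradNormSq (Φ.grad v) ∂μ)) := by
      intro r hr
      obtain ⟨μ, hμ, hint, hE, hG, hdef⟩ := hgap r hr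
      exact ⟨μ, hμ, hint, hE, hG, hdef⟩
    obtain ⟨μ, hsss, -, -, -⟩ := hK f hf E' G₁ hnear
    exact hN f hf μ hsss
  -- (2) R: threshold and constants for the rough regime at level E
  obtain ⟨G₁, c, δ₀, hc, hδ₀, hrough⟩ := hR f hf gap E
  -- (3) the gap at (E, G₁) and the patch
  obtain ⟨r, hr, hgapE⟩ := gap E G₁
  refine ⟨c, min δ₀ (r / 2), hc, lt_min hδ₀ (by linarith), ?_⟩
  intro μ hμ hint hEμ hG hshell R hR0 hRδ hdef
  rcases le_or_gt (ENNReal.ofReal G₁) (Literature.Analysis.FluidPDE.Torus.ensembleEnstrophy μ) with hbig | hsmall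
  · -- rough regime: R's conclusion
    exact hrough μ hμ hint hEμ hG hbig hshell R hR0 (hRδ.trans (min_le_left _ _)) hdef
  · -- tame regime: defect ≤ R ≤ r/2 < r contradicts the gap — vacuous
    exfalso
    refine hgapE μ hμ hint hEμ hsmall.le ?_
    intro Φ
    refine ⟨(hdef Φ).1, (hdef Φ).2.trans ?_⟩
    have hRr : R ≤ r := (hRδ.trans (min_le_right _ _)).trans (by linarith)
    exact mul_le_mul_of_nonneg_right hRr (Real.sqrt_nonneg _)

/-- **Statistical Lamb rigidity of `f_GP`** — the route declaration `EnsembleRigidity.GPStatisticalRigidity`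
(item stmt-AnomalousDissipation-15508) BY NAME, from the three by-name stubs. -/
theorem GPStatisticalRigidity_of :
    Summit.AnomalousDissipation.AnomalousDissipation.Theses.EnsembleRigidity.GPStatisticalRigidity :=
  gpStatisticalRigidity_of_regimes stub_eulerCoercive stub_tameClosure stub_tameToRough

end Summit.AnomalousDissipation.AnomalousDissipation.Cruxes.GPStatisticalRigidity.RegimeSplit

end
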